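import Summits.BirchSwinnertonDyer.BirchSwinnertonDyer.Theorems.TeichmullerTwistDescentCarrierDatum
import Literature.NumberTheory.ModularSymbols.FullLevelHomologySpreadKernel
import Literature.NumberTheory.GaussSums.QuadraticCharacterTeichmuller
import HarnessLib

/-!
# Route `TeichmullerTwistDescent`, crux K `TwistedPeriodLatticeSaturation` (stmt-BirchSwinnertonDyer-25368):
# the carrier datum with hypotheses (H1)/(H2) discharged by Knapp's presentation and multiplicity one

Cell `pub/bsd-wall` (D-0145 line route-BirchSwinnertonDyer-TeichmullerTwistDescent, OPEN rev 7), seat `bsd-line-ttd-p1`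
(prover 1/2, g24).  THEOREMS ONLY (no definition, no named fact, no `sorry`).  BSD is not proved by this file; K is NOT
proved by this file; nothing here closes an item.  `--supports stmt-BirchSwinnertonDyer-25368`.

`TeichmullerTwistDescentCarrierDatum.not_caseOne_of_carrier` refutes case (1) of the Gauss-sum dichotomy from the
full-level carrier granted, among others, the two kernel hypotheses
(H1) `SpreadKernelHyp ℤ_p p M hpM f` and (H2) `TwistedSpreadKernelHyp ℤ_p p M hpM f ω̃^{(p-1)/2}`.
`Literature.…FullLevelHomologySpreadKernel` proves (H2) outright from Knapp's presentation of `H₁(Γ₀(N), ℤ)`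
(`periodFunctional_ker_le_ellipticParabolic_sup_commutator`, a named fact of the tree, taken as the explicit hypothesis `H`)
and `12 ∈ ℤ_pˣ` (automatic for `p ≥ 5`), and reduces (H1) to `H` plus the multiplicity-one hypothesis `MultOneHyp`;
`Literature.…GaussSums.QuadraticCharacterTeichmuller` proves the dictionary hypothesis (H3) `hθχ : ω̃^{(p−1)/2} = χ` on `ℤ/p`
(a primitive quadratic `χ` mod `p` is `(·/p)`, and `ω̃^{(p−1)/2} = (·/p)` by Euler's criterion).  This file records the
resulting sharper statements:

* `isUnit_twelve` (`p ≥ 5`); `teichmuller_quadInt` ((H3) in the `quadInt` currency of the twist operator);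
* **`not_caseOne_of_carrier_of_knapp`**: `not_caseOne_of_carrier` with (H1), (H2), (H3) replaced by `H` and
  `MultOneHyp ℤ_p p M hpM f`;
* **`saturation_at_of_carrier_of_knapp`**: the crux conclusion at `(W, p, χ)` from the same inputs.

REMAINING INPUTS of the K-line after this file (all explicit hypotheses, none asserted): Knapp's presentation `H`;
`MultOneHyp` (Atkin–Lehner multiplicity one for the newform `f` of level `p²M`, operator-free form); the equivariant
functional `Ψ` on the spread lattice with finite-index image (`hm`) and the reduction-socle bound (`hsoc`); modularity
`exists_isNewformOf`.
-/

set_option linter.dupNamespace false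

noncomputable section

open scoped Pointwise MatrixGroups TensorProduct

open Function CongruenceSubgroup
open Literature.RepresentationTheory.FiniteGroups Literature.RepresentationTheory.FiniteGroups.GL2
  Literature.NumberTheory.EllipticCurves.ModularForms
open Literature.NumberTheory.EllipticCurves (Kato2004.teichmullerChar)
open Literature.NumberTheory.ModularSymbols Literature.NumberTheory.ModularSymbols.FullLevel
open Literature.Algebra.Homology

namespace Summit.BirchSwinnertonDyer.BirchSwinnertonDyer.Theorems.TeichmullerTwistDescent.CarrierKnapp

open WeierstrassCurve Literature.NumberTheory.EllipticCurves
  Summit.BirchSwinnertonDyer.BirchSwinnertonDyer.Theorems.TeichmullerTwistDescent.CarrierDatum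

variable (p M : ℕ) [hp : Fact p.Prime] [NeZero M] [NeZero (p ^ 2 * M)] (hpM : Nat.Coprime p M)
  [Fintype (diagTorus (ZMod p))] [Invertible (Fintype.card (diagTorus (ZMod p)) : ℤ_[p])]

omit [NeZero M] [NeZero (p ^ 2 * M)] [Fintype (diagTorus (ZMod p))] [Invertible (Fintype.card (diagTorus (ZMod p)) : ℤ_[p])] in
/-- `12` is a unit of `ℤ_p` for `p ≥ 5`. -/
theorem isUnit_twelve (hp5 : 5 ≤ p) : IsUnit (12 : ℤ_[p]) := by
  rw [PadicInt.isUnit_iff]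
  have hnd : ¬ (p : ℤ) ∣ 12 := by
    intro hd
    have hd' : p ∣ 12 := by exact_mod_cast hd
    have hle : p ≤ 12 := Nat.le_of_dvd (by norm_num) hd'
    have hpr := hp.out
    interval_cases p <;> first | omega | exact absurd hpr (by norm_num)
  have hlt := PadicInt.norm_int_lt_one_iff_dvd (p := p) 12
  push_cast at hlt
  exact le_antisymm (PadicInt.norm_le_one _) (not_lt.1 (mt hlt.1 hnd))

omit [NeZero M] [NeZero (p ^ 2 * M)] [Fintype (diagTorus (ZMod p))] [Invertible (Fintype.card (diagTorus (ZMod p)) : ℤ_[p])] in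
/-- **(H3) discharged**: for a primitive quadratic `χ` mod an odd prime `p`, `ω̃^{(p−1)/2}(w) = quadInt χ w` in `ℤ_p` for every
`w ∈ ℤ/p` (`Literature.…GaussSums.ofUnitHom_teichmullerChar_pow_half_eq_of_isPrimitive` with `n = quadInt χ w`, `χ(w) = n` by
`cast_quadInt`). -/
theorem teichmuller_quadInt (hp2 : p ≠ 2) {χ : DirichletCharacter ℂ p} (hχ : χ.IsQuadratic) (hprim : χ.IsPrimitive)
    (w : ZMod p) : MulChar.ofUnitHom (Kato2004.teichmullerChar p ^ ((p - 1) / 2)) w = (quadInt χ w : ℤ_[p]) :=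
  Literature.NumberTheory.GaussSums.ofUnitHom_teichmullerChar_pow_half_eq_of_isPrimitive p hp2 hχ hprim w
    (cast_quadInt χ hχ w).symm

/-- **Case (1) of the Gauss-sum dichotomy is impossible, from the carrier, Knapp's presentation and multiplicity one**:
`CarrierDatum.not_caseOne_of_carrier` with its kernel hypotheses (H1) `SpreadKernelHyp` and (H2) `TwistedSpreadKernelHyp`
replaced by Knapp's presentation `H` (hypothesis) and `MultOneHyp ℤ_p p M hpM f` (hypothesis), via
`spreadKernelHyp_of_knapp_of_multOne` and `twistedSpreadKernelHyp_of_knapp` (`12 ∈ ℤ_pˣ` as `p ≥ 5`), and the dictionary (H3)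
supplied by `teichmuller_quadInt`. -/
theorem not_caseOne_of_carrier_of_knapp (hp5 : 5 ≤ p) {k : Type} [Field k] [CharP k p] [Algebra ℤ_[p] k] [Finite k]
    (hsurj : Surjective (algebraMap ℤ_[p] k))
    (halg : ∀ x : ℤ_[p], algebraMap ℤ_[p] k x = ZMod.castHom (dvd_refl p) k (PadicInt.toZMod x))
    (f : CuspForm (Gamma0 (p ^ 2 * M)) 2) {b : ℕ} (hb : 0 < b) (hb2 : 2 * b < p - 1)
    {χ : DirichletCharacter ℂ p} (hχ : χ.IsQuadratic) (hprim : χ.IsPrimitive)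
    (Ψ : spreadLattice ℤ_[p] p M hpM f →ₗ[ℤ_[p]] (Option (ZMod p) → ℤ_[p]))
    (hΨ : IsEquivariantOnSpread ℤ_[p] p M hpM f
      (coordRep (Kato2004.teichmullerChar p ^ (p - 1 - b)) (Kato2004.teichmullerChar p ^ b)) Ψ)
    {m : ℕ} (hm : ∀ v : Option (ZMod p) → ℤ_[p], (p : ℤ_[p]) ^ m • v ∈ LinearMap.range Ψ)
    (hsoc : ∀ Λ' : Subrepresentation (coordRep (Kato2004.teichmullerChar p ^ (p - 1 - b)) (Kato2004.teichmullerChar p ^ b)),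
      Λ'.toSubmodule = LinearMap.range Ψ →
        ReductionSocleLe p k (Kato2004.teichmullerChar p ^ (p - 1 - b)) (Kato2004.teichmullerChar p ^ b) (2 * b) Λ')
    (H : periodFunctional_ker_le_ellipticParabolic_sup_commutator) (hM1 : MultOneHyp ℤ_[p] p M hpM f)
    (hcase : ∀ w ∈ periodLattice (charTwist (p ^ 2 * M) dvd_rfl (dvd_mul_right (p ^ 2) M) hχ f), ∃ z ∈ periodLattice f,
      gaussSum χ (ZMod.stdAddChar (N := p)) * w = (p : ℂ) * z) : False := by
  have hp2 : p ≠ 2 := by omega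
  haveI : Invertible (12 : ℤ_[p]) := (isUnit_twelve p hp5).invertible
  exact not_caseOne_of_carrier p M hpM hp2 hsurj halg f hb hb2 hχ hprim Ψ hΨ hm hsoc
    (spreadKernelHyp_of_knapp_of_multOne ℤ_[p] p M hpM H f hM1)
    (twistedSpreadKernelHyp_of_knapp ℤ_[p] p M hpM H f _) (teichmuller_quadInt p hp2 hχ hprim) hcase

/-- **The crux conclusion at `(W, p, χ)` from the carrier, Knapp's presentation and multiplicity one**:
`CarrierDatum.saturation_at_of_carrier` with (H1)/(H2) replaced by `H` and `MultOneHyp ℤ_p p M hpM D.f` and (H3) proved. -/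
theorem saturation_at_of_carrier_of_knapp (hnf : exists_isNewformOf) (W : WeierstrassCurve ℚ) [W.IsElliptic] [W.IsGloballyMinimal]
    (hN : W.conductorNorm ℤ = p ^ 2 * M) (D : ModularParametrizationData W (p ^ 2 * M))
    (hp11 : 11 ≤ p) (hadd : Rank1Residual.Addv W p) (hirr : Rank1Residual.Irr W p)
    (hGo : Summit.BirchSwinnertonDyer.Rank1Residual.Additive.TypeGOrd W p)
    (hV4 : padicValInt p W.minimalDiscriminantInt ≤ 4)
    (hopt : ∀ z ∈ D.L.lattice, ∃ w ∈ periodLattice D.f, z = D.c * w)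
    (χ : DirichletCharacter ℂ p) (hχ : χ.IsQuadratic) (hprim : χ.IsPrimitive)
    {k : Type} [Field k] [CharP k p] [Algebra ℤ_[p] k] [Finite k]
    (hsurj : Surjective (algebraMap ℤ_[p] k))
    (halg : ∀ x : ℤ_[p], algebraMap ℤ_[p] k x = ZMod.castHom (dvd_refl p) k (PadicInt.toZMod x))
    {b : ℕ} (hb : 0 < b) (hb2 : 2 * b < p - 1)
    (Ψ : spreadLattice ℤ_[p] p M hpM D.f →ₗ[ℤ_[p]] (Option (ZMod p) → ℤ_[p]))
    (hΨ : IsEquivariantOnSpread ℤ_[p] p M hpM D.f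
      (coordRep (Kato2004.teichmullerChar p ^ (p - 1 - b)) (Kato2004.teichmullerChar p ^ b)) Ψ)
    {m : ℕ} (hm : ∀ v : Option (ZMod p) → ℤ_[p], (p : ℤ_[p]) ^ m • v ∈ LinearMap.range Ψ)
    (hsoc : ∀ Λ' : Subrepresentation (coordRep (Kato2004.teichmullerChar p ^ (p - 1 - b)) (Kato2004.teichmullerChar p ^ b)),
      Λ'.toSubmodule = LinearMap.range Ψ →
        ReductionSocleLe p k (Kato2004.teichmullerChar p ^ (p - 1 - b)) (Kato2004.teichmullerChar p ^ b) (2 * b) Λ')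
    (H : periodFunctional_ker_le_ellipticParabolic_sup_commutator) (hM1 : MultOneHyp ℤ_[p] p M hpM D.f) :
    ∀ z ∈ periodLattice D.f, ∃ w ∈ periodLattice (charTwist (p ^ 2 * M) (dvd_refl _) (dvd_mul_right (p ^ 2) M) hχ D.f),
      z = gaussSum χ (ZMod.stdAddChar (N := p)) * w := by
  have hp5 : 5 ≤ p := by omega
  haveI : Invertible (12 : ℤ_[p]) := (isUnit_twelve p hp5).invertible
  exact saturation_at_of_carrier p M hpM hnf W hN D hp11 hadd hirr hGo hV4 hopt χ hχ hprim hsurj halg hb hb2 Ψ hΨ hm hsoc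
    (spreadKernelHyp_of_knapp_of_multOne ℤ_[p] p M hpM H D.f hM1)
    (twistedSpreadKernelHyp_of_knapp ℤ_[p] p M hpM H D.f _) (teichmuller_quadInt p (by omega) hχ hprim)

end Summit.BirchSwinnertonDyer.BirchSwinnertonDyer.Theorems.TeichmullerTwistDescent.CarrierKnapp
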